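import Literature.NumberTheory.EllipticCurves.CastellaGrossiSkinner2025.MazurMainConjecture
import Literature.NumberTheory.EllipticCurves.Rank1Residual.ClassX1KellerYinMainConjecture
import Literature.NumberTheory.EllipticCurves.Rank1Residual.X1MainConjecture
import Literature.NumberTheory.EllipticCurves.Rank1Residual.EisensteinGoodComplement
import Literature.NumberTheory.EllipticCurves.QuadraticTwistProofs
import Literature.NumberTheory.EllipticCurves.Rank1Residual.GVParityTwistTransportProofs
import Literature.NumberTheory.EllipticCurves.Rank1Residual.EisensteinGoodComplementSplit
import HarnessLib

/-!
# Castella–Grossi–Lee–Skinner 2022, proof of Thm. 5.3.1, display (5.7): the rank-one / rank-zero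
# twist identity at a NON-ANOMALOUS Eisenstein prime — and CGS 2025 Thm. D (`r = 1`) re-assembled

HONEST FRAMING (cell `b2b-bsdres`, run/shared/lean/b2b/bsd-rank1-residual/; page 1 everywhere):
the goal of the cell is to DELETE the COMBINATION-SHAPED residual classes of the BSD formula for ALL
analytic-rank `≤ 1` curves over `ℚ` from PUBLISHED theorems only, so that the remainder becomes
exactly the CONSTRUCTION-SHAPED classes, which are TYPED, not attempted; this is not "finishing
BSD". This file vendors ONE published statement as a named fact (`def … : Prop`, nothing asserted;
D-0014/D-0026) and PROVES its consumers. Unit `b2b-bsdres-lit-cgls` (off-peak literature typer,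
source = Castella–Grossi–Lee–Skinner 2022 and Greenberg–Vatsal 2000), session 2.

## What and why

The covered row C6 of the cell (`2 < p`, `E[p]` reducible, good reduction, `a_p ≢ 1 (mod p)`;
`Partition/Rows.lean`) rests on ONE named fact, Castella–Grossi–Skinner 2025 Thm. D
(`CastellaGrossiSkinner2025.thmD_padicValRat_bsd_rank_le_one`, registry A47). Its printed proof is
two sentences: "In the case `r = 0`, the argument is the same as in [CGLS22], replacing the appeal to
[GV00] by an appeal to our Theorem A. In the case `r = 1`, we argue as in [CGLS22], choosing a
suitable `K` with `L(E^K,1) ≠ 0` and applying our result in the rank `0` case to `E^K`"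
(`[corpus: paper:arxiv-2303.04373 p0005 L59–L61]`). Session 1 of this seat put the `r = 0` sentence
in the kernel (`CastellaGrossiSkinner2025.pPartRankZero_of_thmA`, from the typed Theorem A). This
file puts the `r = 1` sentence in the kernel. "We argue as in [CGLS22]" is the proof of CGLS22
Thm. 5.3.1 up to its display (5.7) — the identity between the `p`-adic valuations of the normalised
leading terms of `E` (rank `1`) and of the twist `E^K` (rank `0`) — which the ANTICYCLOTOMIC
package of CGLS22 (Thm. 4.2.2 = Iwasawa–Greenberg / BDP main conjecture for `𝔛_E`, Thm. 5.1.1 =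
anticyclotomic control, Thm. 5.1.3 = Bertolini–Darmon–Prasanna formula, Thm. 5.1.2 = Gross–Zagier,
Kolyvagin, Skinner–Zhang's Tamagawa identity) establishes under ONLY `φ|_{G_p} ≠ 1, ω` — the parity
bullet of Thm. 5.3.1 is invoked AFTER (5.7), in the last sentence of the proof, to kill the
right-hand side by [GV00]. CGS 2025 kills it by Theorem A instead. The anticyclotomic objects
`𝔛_E`, `𝓛_E ∈ Λ^ur` have no Literature definition today (SIZED ASK S1 of the seat's deliverable), so
the typable published statement closest to those main conjectures is exactly this display; the
twin display at an ANOMALOUS Eisenstein prime is Keller–Yin's (preprint; typed OPEN as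
`KellerYin2024.thm421_rankOne_display_OPEN`, same binder shape plus torsion terms).

## Citation header (read by this seat on the arXiv TeX source of v2 = the FINAL arXiv version, 2021-09-14,
## "Final version, to appear in Invent. Math" — arXiv lists v1 and v2 only; "v3" in the first filing of
## this docstring was a slip for v2 (locator nit `CGLS22-no-v3`, CITED-FACTS A149) — = the version of record's text,
`Eisenstein.tex` L2596–L2663, and on the store's LaTeXML text `paper:arxiv-2008.02571` p0025)

* Authors: Francesc Castella, Giada Grossi, Jaehoon Lee, Christopher Skinner.
* Title: *On the anticyclotomic Iwasawa theory of rational elliptic curves at Eisenstein primes*.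
* Venue: Invent. Math. **227** (2022) 517–580, doi:10.1007/s00222-021-01072-y = arXiv:2008.02571v2
  (bib key `CastellaGrossiLeeSkinner2022`; older tree key `CastellaEtAl2021`). REFEREED / PUBLISHED.
* Statement: **display (5.7)** (TeX label `eq:thmA-bisbis`) in the proof of **Theorem 5.3.1**
  (= Theorem F of the Introduction; §5.3 "Proof of the `p`-part of BSD formula"), p0025 L61–L115.
* Hypotheses in force at (5.7), word for word (opening of Thm. 5.3.1 and of its proof): "Let `E/ℚ`
  be an elliptic curve, and let `p > 2` be a prime of good ordinary reduction for `E`. Assume that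
  `E` admits a cyclic `p`-isogeny with kernel `C = 𝔽_p(φ)`, with `φ : G_ℚ → 𝔽_p^×` such that
  `φ|_{G_p} ≠ 1, ω` [the second bullet, "`φ` is either ramified at `p` and odd, or unramified at `p`
  and even", is used only in the sentence after (5.7)]. … Suppose `ord_{s=1} L(E,s) = 1` and choose
  … an imaginary quadratic field `K` of discriminant `D_K` such that (a) `D_K < -4` is odd, (b) every
  prime `ℓ` dividing `N` splits in `K`, (c) `p` splits in `K`, say `p = v v̄`, (d) `L(E^K,1) ≠ 0`."
* Verbatim (5.7):

> `ord_p( L'(E,1) / (Reg(E/ℚ)·Ω_E·∏_ℓ c_ℓ(E/ℚ)) ) − ord_p(#Ш(E/ℚ))`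
> `  = ord_p( L(E^K,1) / (Ω_{E^K}·∏_ℓ c_ℓ(E^K/ℚ)) ) − ord_p(#Ш(E^K/ℚ))`,

  preceded by "Since `Ш(E/K)[p^∞] ≃ Ш(E/ℚ)[p^∞] ⊕ Ш(E^K/ℚ)[p^∞]` as `p` is odd, and
  `∑_{w|ℓ} ord_p(c_w(E/K)) = ord_p(c_ℓ(E/ℚ)) + ord_p(c_ℓ(E^K/ℚ))` for any prime `ℓ` (see [Skinner–Zhang,
  Cor. 9.2]), combining (5.5) and (5.6) we arrive at (5.7)", where
  (5.5) `ord_p(#Ш(E/K)) = 2 ord_p(c_E^{-1} u_K^{-1}·[E(K):ℤ.P_K]) − ∑_{w∈S} ord_p(c_w(E/K))`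
  (from Thm. 4.2.2 via `𝓕_E(0) = u·𝓛_E(0)`, Thm. 5.1.1 with `P = P_K` — "The hypotheses on `φ` imply
  that `E(K)[p] = 0`" —, Thm. 5.1.3 and (4.2)) and
  (5.6) `L'(E,1)/(Reg(E/ℚ)·Ω_E) · L(E^K,1)/Ω_{E^K} = 2^t c_E^{-2} u_K^{-2}·[E(K):ℤ·P_K]²`
  (Gross–Zagier, `u_K = 1` since `D_K < -4`), and followed by "Finally, by our hypotheses on `φ` the
  curve `E^K` satisfies the hypotheses of Theorem 5.1.4 [GV00], and hence the right-hand side of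
  (5.7) vanishes, concluding the proof".
* READING NOTE `CGLS22-(5.7)-sign` (for the referee's N-audit; nothing printed is affected):
  combining (5.5) and (5.6) as the text says gives
  `ord_p q + ord_p q_K = ord_p#Ш(E) + ord_p#Ш(E^K) + ∑_ℓ ord_p c_ℓ(E) + ∑_ℓ ord_p c_ℓ(E^K)` for
  `q = L'(E,1)/(Reg·Ω_E)`, `q_K = L(E^K,1)/Ω_{E^K}`, i.e. `[left side of (5.7)] = −[right side]`; the
  typeset relation between the two aligned lines of (5.7) reads `=`. On the paper's locus the right
  side vanishes (last sentence of the proof), so Thm. 5.3.1 is unaffected, and Keller–Yin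
  (arXiv:2402.12781v2, p. 22: "equation (5.7) in [CGLS] becomes …") print the identity with `= −(…)`.
  This file transcribes the identity the displayed derivation yields (`= −`), exactly as the tree's
  Keller–Yin transcription does.

## Transcription (tree predicates, as in every Eisenstein fact of the cell: A47, A52, CGLS Thm. E, CGS Thms. A, C)

"`p > 2` … good ordinary" = `2 < p`, `Good W p` (ordinary is automatic at a good Eisenstein `p > 2`,
tree theorem `goodOrd_of_red_of_good`, Serre 1972); "admits a cyclic `p`-isogeny" = `Red W p`
(CGLS §0.1: equivalently `E[p]` reducible); "`φ|_{G_p} ≠ 1, ω`" = `¬ Anom W p` (`a_p ≢ 1 (mod p)`;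
dictionary `not_anom_iff_cgs_of_mem_primesAbove`, symmetric in `{φ, ψ = ωφ⁻¹}`);
"`ord_{s=1}L(E,s) = 1`" = `W.analyticRank = 1`; (a)–(d) and the model `Wd` of `E^K = E^{(D_K)}`, and
the rationals `q = L'(E,1)/(Reg·Ω_E)` (Gross–Zagier 1986 Thm. I.7.3) and `q_K = L(E^K,1)/Ω_{E^K}`
(Manin–Drinfeld): the binder list of `KellerYin2024.thm421_rankOne_display_OPEN` VERBATIM (so the two
displays are interchangeable term for term), `#Ш = shaOrder` (finite for `E` and `E^K` by
Gross–Zagier–Kolyvagin, which the proof invokes before (5.5)), `∏_ℓ c_ℓ = tamagawaProduct`,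
`Ω = realPeriodRat` (Néron period of the minimal model, the paper's `Ω_E`), `Reg = regulator`. No
torsion terms (none are printed: `E(K)[p] = 0`).

## Contents

* `display57_rankOne_twist` — the named fact (ONE new `def … : Prop`); registry A149, now
  RETIRED-DERIVED (derived in the kernel from A157 = display (5.5) by
  `Summit.BirchSwinnertonDyer.Rank1Residual.display57_of_display55`, p244446 — see the decl docstring).
* PROVED: `frobeniusTrace_eq_of_split_twist` (`a_p(E^K) = a_p(E)` for `p` split in `K`, Knapp
  Prop. 12.10 — the tree's discharged `frobeniusTrace_quadraticTwist_holds`),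
  `partner_good_red_not_anom` (the twist is again good, Eisenstein and NON-anomalous at `p`: the
  hypotheses of CGS Thm. A / Thm. D transport to `E^K`), `display_at_of_display57` (the Keller–Yin
  shaped instance, torsion terms vanishing by `not_dvd_torsionOrder_of_not_anom`),
  `bsdp_rankOne_of_display57_of_partner` ((5.7) + the rank-`0` print shape of the partner ⇒ Miller's
  `BSD(E,p)`), `bsdp_rankOne_of_display57_of_thmA` (**CGS 2025 Thm. D, `r = 1`, from its printed
  pieces**: (5.7) + Theorem A for `E^K` + Greenberg Thm. 4.1 + modularity + Hoffstein–Luo +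
  Gross–Zagier + GZK), `bsdp_of_display57_of_thmA` (`r ≤ 1`: with session 1's `r = 0` half — the
  whole of Thm. D re-assembled; compare `CastellaGrossiSkinner2025.bsdp_of_thmD`, which takes Thm. D
  itself as the named fact), the per-pair bookkeeping `display_at_iff_bsdp_of_not_anom`; and (appended)
  `pPartRankZero_partner_of_gvThm13_of_coType`, `bsdp_rankOne_of_display57_of_gvThm13`
  (`_of_not_gvPar`) — **CGLS22 Theorem F (= Thm. 5.3.1) itself re-assembled from (5.7) +
  Greenberg–Vatsal 2000 Thm. 1.3 on the partner**, i.e. the printed proof of Thm. 5.3.1 end to end,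
  with NO Castella–Grossi–Skinner 2025 input (so outside the cell's `CGS25-BST-Thm311` documentation
  flag): compare A52 `bsdp_of_thmF` / `Rank1Residual.bsdp_of_thmF_of_not_gvPar`, which take Thm. F
  itself as the named fact.

## References
* [CastellaGrossiLeeSkinner2022] F. Castella, G. Grossi, J. Lee, C. Skinner, Invent. Math. 227
  (2022) = arXiv:2008.02571v2 (final): Thm. 5.3.1 and its proof, displays (5.5)–(5.7); Thm. 4.2.2, Thms.
  5.1.1–5.1.4, Rem. 4.1.2 (4.2).
* [CastellaGrossiSkinner2025] F. Castella, G. Grossi, C. Skinner, Math. Ann. 393 (2025): Thm. D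
  (= "Thm. 4") and its proof (§0.3 p. 5); Theorem A (tree fact `thmA_charIdeal_eq_padicLFunction`).
* [KellerYin2024] T. Keller, M. Yin, arXiv:2402.12781v2, proof of Thm. 4.2.1 (p. 22) — the anomalous
  twin of the display (tree `KellerYin2024.thm421_rankOne_display_OPEN`, OPEN).
* [Knapp1993] A. Knapp, *Elliptic Curves*, Prop. 12.10 — `a_p` of a quadratic twist.
* [GreenbergLNM1716] R. Greenberg, LNM 1716 (1999), Thm. 4.1 — `greenberg_charValue_rankZero`.
* [HoffsteinLuo1997], [GrossZagier1986] Thm. I.7.3, [Miller2011LMS] Def. 1.1 — as in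
  `Rank1Residual/ClassX1KellerYin.lean`, whose rank-one assembly this file mirrors for the
  published (non-anomalous) display.
* HOME/CITED-FACTS.md A47 (Thm. D), A52 (Thm. F); RESIDUAL-CASES.md §a.1 C6; deliverable
  HOME/b2b-bsdres-lit-cgls/CGLS-GV-TYPING.md §9 (session 2).
-/

set_option autoImplicit false

noncomputable section

open scoped Classical MatrixGroups ModularForm

open CongruenceSubgroup WeierstrassCurve Literature.NumberTheory.EllipticCurves
  Literature.NumberTheory.EllipticCurves.ModularForms Literature.NumberTheory.QuadraticFields
  Literature.NumberTheory.EllipticCurves.Rank1Residual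

namespace Literature.NumberTheory.EllipticCurves.CastellaGrossiLeeSkinner2022

/-- **Castella–Grossi–Lee–Skinner, Invent. Math. 227 (2022) = arXiv:2008.02571v2 (final), display (5.7)
(`eq:thmA-bisbis`) of the proof of Theorem 5.3.1 (§5.3).** Under the hypotheses in force there —
"`E/ℚ` an elliptic curve, `p > 2` a prime of good ordinary reduction for `E`, `E` admits a cyclic
`p`-isogeny with kernel `C = 𝔽_p(φ)`, `φ|_{G_p} ≠ 1, ω`; `ord_{s=1} L(E,s) = 1`; `K` an imaginary
quadratic field of discriminant `D_K` such that (a) `D_K < -4` is odd, (b) every prime `ℓ` dividing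
`N` splits in `K`, (c) `p` splits in `K`, (d) `L(E^K,1) ≠ 0`" (the parity bullet of Thm. 5.3.1 is
NOT among them: it enters only after (5.7)) — the proof establishes, "combining (5.5) and (5.6)"
(Thm. 4.2.2, the anticyclotomic Iwasawa–Greenberg statement for `𝔛_E`; Thm. 5.1.1 control; Thm. 5.1.3 BDP
formula; Thm. 5.1.2 Gross–Zagier, Kolyvagin, `Ш(E/K)[p^∞] ≃ Ш(E/ℚ)[p^∞] ⊕ Ш(E^K/ℚ)[p^∞]`,
Skinner–Zhang Cor. 9.2): "`ord_p(L'(E,1)/(Reg(E/ℚ)·Ω_E·∏_ℓ c_ℓ(E/ℚ))) − ord_p(#Ш(E/ℚ))`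
[`= −`, reading note `CGLS22-(5.7)-sign` in the module docstring]
`ord_p(L(E^K,1)/(Ω_{E^K}·∏_ℓ c_ℓ(E^K/ℚ))) − ord_p(#Ш(E^K/ℚ))`". Transcribed for a globally minimal
model `W` (`Ω_E = realPeriodRat`), `2 < p`, `Good W p`, `Red W p`, `¬ Anom W p`,
`W.analyticRank = 1`, the field binders (a)–(d) and the globally minimal model `Wd` of
`E^K = E^{(D_K)}` VERBATIM as in `KellerYin2024.thm421_rankOne_display_OPEN`, and stated for the
rationals `q = L'(E,1)/(Ω_E·Reg(E/ℚ))` (Gross–Zagier 1986 Thm. I.7.3) and `qd = L(E^K,1)/Ω_{E^K}`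
(Manin–Drinfeld), with `#Ш = shaOrder` (finite on both sides by Gross–Zagier–Kolyvagin, invoked in
the proof before (5.5)). No torsion terms are printed (`E(K)[p] = 0`). PUBLISHED.

**RETIRED-DERIVED** (registry A149; cell-lead ruling, CITED-FACTS.md lit GEN 40 block, executing
referee R126 §C.6 / R126.7; phase 1b of the deprecate-and-add procedure, as for A86/A87/A154 —
docstring only, the `def` body is unchanged): this named fact is no longer an INDEPENDENT input of
the cell. It is DERIVED in the kernel from A157 = display (5.5)
(`CastellaGrossiLeeSkinner2022.display55_sha_heegnerIndex`, `HeegnerIndexIdentity.lean`) together with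
published Heegner-point facts, by
`Summit.BirchSwinnertonDyer.Rank1Residual.display57_of_display55 : display55_sha_heegnerIndex →
nonempty_modularParametrizationData → (∀ gross_zagier) → (∀ kolyvagin) →
rank_eq_analyticRank_of_analyticRank_le_one → hasEntireLFunction_rat → display57_rankOne_twist`
(and `display57_of_display55'`, pointwise `TwistIdentity.display57_at_of_display55`) in
`Summits/BirchSwinnertonDyer/Rank1Residual/Partition/MainConjecturesEisensteinTwistIdentity.lean`
(p244446) — the printed step "combining (5.5) and (5.6) we arrive at (5.7)" carried out in the
kernel, sign included. RULE for consumers: no NEW theorem may bind `h57 : display57_rankOne_twist`;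
take `display57_of_display55' h55 hmodP hnf hGZ hKo hGZK` (or the (5.5)-fed twins
`RowC6.bsdp_of_display55_of_cgsThmA`, `RowC6.bsdp_rankOne_of_display55_of_gvThm13`,
`RowC6.cgsThmD_of_display55_of_cgsThmA`, `RowC6.cglsThmF_of_display55_of_gvThm13`). The `def` stays
verbatim while binders of record exist (the `h57` theorems of this file; `Partition/
MainConjecturesEisenstein.lean` §4; `Partition/MainConjecturesEisensteinTwistIdentity.lean`);
phase 2 re-points them and removes the `def` (registry −1 then; today the count is unchanged — a
conditional corollary, not a discharge). Flag `CGLS-display57-proof-internal` RETIRED by the same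
ruling; `CGLS22-(5.7)-sign` is now a kernel computation.
[cite: CastellaGrossiLeeSkinner2022, proof of Thm. 5.3.1, display (5.7) (with (5.5), (5.6)); §5.3]
[cite: KellerYin2024, proof of Thm. 4.2.1 (p. 22) (the restatement "equation (5.7) in [CGLS] becomes …", binder shape reused)] -/
def display57_rankOne_twist : Prop :=
  ∀ (W : WeierstrassCurve ℚ) [W.IsElliptic] [W.IsGloballyMinimal] (p : ℕ) [Fact p.Prime],
    2 < p → Good W p → Red W p → ¬ Anom W p → W.analyticRank = 1 →
    ∀ (K : Type) [Field K] [NumberField K], IsImaginaryQuadratic K →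
      Odd (NumberField.discr K) → NumberField.discr K < -4 →
      SatisfiesHeegnerHypothesis (W.conductorNorm ℤ) K → SatisfiesHeegnerHypothesis p K →
      (W.quadraticTwist (NumberField.discr K : ℚ)).entireLFunction 1 ≠ 0 →
    ∀ (Wd : WeierstrassCurve ℚ) [Wd.IsElliptic] [Wd.IsGloballyMinimal],
      (∃ C : VariableChange ℚ, C • Wd = W.quadraticTwist (NumberField.discr K : ℚ)) →
    ∀ (q qd : ℚ), W.leadingLCoeff / ((W.realPeriodRat * W.regulator : ℝ) : ℂ) = (q : ℂ) →
      Wd.entireLFunction 1 / (Wd.realPeriodRat : ℂ) = (qd : ℂ) →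
      padicValRat p q - padicValNat p W.tamagawaProduct - padicValNat p W.shaOrder =
        -(padicValRat p qd - padicValNat p Wd.tamagawaProduct - padicValNat p Wd.shaOrder)

variable {W : WeierstrassCurve ℚ} [W.IsElliptic] [W.IsGloballyMinimal] {p : ℕ} [Fact p.Prime]

/-! ### The partner `E^K` at a split prime: `a_p`, reduction, reducibility, anomaly -/

omit [W.IsElliptic] in
/-- **`a_p(E^K) = a_p(E)` when `p` splits in `K`.** For `W/ℚ` globally minimal with good reduction
at an odd prime `p`, an imaginary quadratic `K` with `D_K` odd (so squarefree) in which `p` splits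
(`(D_K/p) = 1`, `satisfiesHeegnerHypothesis_iff_kronecker`), and a globally minimal model `Wd` of
`E^{(D_K)}`: `a_p(Wd) = (D_K/p)·a_p(W) = a_p(W)` (Knapp Prop. 12.10, the tree's discharged
`frobeniusTrace_quadraticTwist_holds`). The twist character `ε_K` is trivial on `G_p`.
[cite: Knapp1993, Prop. 12.10] [cite: CastellaGrossiLeeSkinner2022, proof of Thm. 5.3.1, condition (c)] -/
theorem frobeniusTrace_eq_of_split_twist [W.IsElliptic] (hp : 2 < p) (hgood : Good W p)
    (K : Type) [Field K] [NumberField K] (hK : IsImaginaryQuadratic K)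
    (hodd : Odd (NumberField.discr K)) (hHp : SatisfiesHeegnerHypothesis p K)
    (Wd : WeierstrassCurve ℚ) [Wd.IsGloballyMinimal]
    (hWd : ∃ C : VariableChange ℚ, C • Wd = W.quadraticTwist (NumberField.discr K : ℚ)) :
    Wd.frobeniusTrace p = W.frobeniusTrace p := by
  have hpP : p.Prime := Fact.out
  have hp2 : p ≠ 2 := by omega
  have hsqf : Squarefree (NumberField.discr K) := squarefree_discr_of_odd hK hodd
  have hpd : ¬ (p : ℤ) ∣ NumberField.discr K := not_dvd_discr_of_split hK hpP hp2 hHp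
  have hj : jacobiSym (NumberField.discr K) p = 1 :=
    ((satisfiesHeegnerHypothesis_iff_kronecker p K hK.1).mp hHp p hpP dvd_rfl).2 hp2
  have hp2d : ¬ (p : ℤ) ∣ 2 * NumberField.discr K := by
    intro h
    rcases (Nat.prime_iff_prime_int.mp hpP).dvd_or_dvd h with h2 | h2
    · have h2' : (p : ℤ) ≤ 2 := Int.le_of_dvd two_pos h2
      omega
    · exact hpd h2
  have hΔ : ¬ (p : ℤ) ∣ W.minimalDiscriminantInt :=
    W.not_dvd_minimalDiscriminantInt_of_hasGoodReductionAtPrime' p hgood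
  have htw := frobeniusTrace_quadraticTwist_holds W Wd (NumberField.discr K) hsqf hWd p hp2d hΔ
  rw [jacobiSym.legendreSym.to_jacobiSym, hj, one_mul] at htw
  exact htw

/-- **The hypotheses of CGS Thm. A / Thm. D transport to the partner.** For `W/ℚ` globally minimal
elliptic, `p > 2` good with `E[p]` reducible and `a_p ≢ 1 (mod p)`, `K` imaginary quadratic with
`D_K` odd and `p` split, and a globally minimal model `Wd` of `E^{(D_K)}`: `Wd` has good reduction at
`p` (`isOrdinaryAt_of_smul_eq_quadraticTwist`, `p ∤ 2D_K`), `Wd[p]` is reducible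
(`not_hasIrreducibleModPGaloisRep_twist`: a sign does not move a rational line) and `Wd` is NOT
anomalous at `p` (`a_p(Wd) = a_p(W)`, `frobeniusTrace_eq_of_split_twist`). This is the content of
"applying our result in the rank `0` case to `E^K`" in the proof of CGS Thm. D.
[cite: CastellaGrossiSkinner2025, proof of Thm. D (§0.3 p. 5)] [cite: Knapp1993, Prop. 12.10]
[cite: SilvermanAEC2009, X.5 Cor. 5.4] -/
theorem partner_good_red_not_anom (hp : 2 < p) (hgood : Good W p) (hred : Red W p)
    (hna : ¬ Anom W p) (K : Type) [Field K] [NumberField K] (hK : IsImaginaryQuadratic K)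
    (hodd : Odd (NumberField.discr K)) (hHp : SatisfiesHeegnerHypothesis p K)
    (Wd : WeierstrassCurve ℚ) [Wd.IsElliptic] [Wd.IsGloballyMinimal]
    (hWd : ∃ C : VariableChange ℚ, C • Wd = W.quadraticTwist (NumberField.discr K : ℚ)) :
    Good Wd p ∧ Red Wd p ∧ ¬ Anom Wd p := by
  have hpP : p.Prime := Fact.out
  have hp2 : p ≠ 2 := by omega
  obtain ⟨C, hC⟩ := hWd
  have hsqf : Squarefree (NumberField.discr K) := squarefree_discr_of_odd hK hodd
  have hpd : ¬ (p : ℤ) ∣ NumberField.discr K := not_dvd_discr_of_split hK hpP hp2 hHp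
  have hord : GoodOrd W p := goodOrd_of_red_of_good W p hp hgood hred
  obtain ⟨hgood_d, -⟩ :=
    isOrdinaryAt_of_smul_eq_quadraticTwist W Wd hsqf hC p hp2 hpd ⟨hord.1, hord.2⟩
  have hd0 : (NumberField.discr K : ℚ) ≠ 0 := by
    exact_mod_cast (IsImaginaryQuadratic.discr_neg hK).ne
  have hred_d : Red Wd p := not_hasIrreducibleModPGaloisRep_twist hred hd0 Wd C hC
  refine ⟨hgood_d, hred_d, fun han ↦ hna ?_⟩
  have ha : Wd.frobeniusTrace p = W.frobeniusTrace p :=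
    frobeniusTrace_eq_of_split_twist hp hgood K hK hodd hHp Wd ⟨C, hC⟩
  exact ⟨hred, hgood, ha ▸ han.2.2⟩

/-! ### (5.7) in the Keller–Yin shape, and the rank-one assembly -/

/-- **(5.7) at one `(E, p, K, Wd)` in the shape of the Keller–Yin display** (the hypothesis `hdisp`
of `Rank1Residual.bsdp_of_display_at_of_pPartRankZero`): the torsion terms that Keller–Yin carry
vanish here, since `p ∤ #E(ℚ)_tors` and `p ∤ #E^K(ℚ)_tors` at a non-anomalous good `p > 2`
(`not_dvd_torsionOrder_of_not_anom`, for `Wd` through `partner_good_red_not_anom`) — CGLS: "the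
hypotheses on `φ` imply that `E(K)[p] = 0`".
[cite: CastellaGrossiLeeSkinner2022, proof of Thm. 5.3.1, display (5.7)]
[cite: KellerYin2024, proof of Thm. 4.2.1 (p. 22)] -/
theorem display_at_of_display57 (h57 : display57_rankOne_twist) (hp : 2 < p) (hgood : Good W p)
    (hred : Red W p) (hna : ¬ Anom W p) (hr : W.analyticRank = 1)
    (K : Type) [Field K] [NumberField K] (hK : IsImaginaryQuadratic K)
    (hodd : Odd (NumberField.discr K)) (hlt : NumberField.discr K < -4)
    (hHN : SatisfiesHeegnerHypothesis (W.conductorNorm ℤ) K) (hHp : SatisfiesHeegnerHypothesis p K)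
    (hLK : (W.quadraticTwist (NumberField.discr K : ℚ)).entireLFunction 1 ≠ 0)
    (Wd : WeierstrassCurve ℚ) [Wd.IsElliptic] [Wd.IsGloballyMinimal]
    (hWd : ∃ C : VariableChange ℚ, C • Wd = W.quadraticTwist (NumberField.discr K : ℚ)) :
    ∀ (q qd : ℚ), W.leadingLCoeff / ((W.realPeriodRat * W.regulator : ℝ) : ℂ) = (q : ℂ) →
        Wd.entireLFunction 1 / (Wd.realPeriodRat : ℂ) = (qd : ℂ) →
        padicValRat p q - ((padicValNat p W.shaOrder : ℤ) + padicValNat p W.tamagawaProduct -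
            2 * padicValNat p W.torsionOrder) =
          -(padicValRat p qd - ((padicValNat p Wd.shaOrder : ℤ) + padicValNat p Wd.tamagawaProduct -
            2 * padicValNat p Wd.torsionOrder)) := by
  intro q qd hq hqd
  obtain ⟨hgood_d, -, hna_d⟩ := partner_good_red_not_anom hp hgood hred hna K hK hodd hHp Wd hWd
  have ht : padicValNat p W.torsionOrder = 0 :=
    padicValNat.eq_zero_of_not_dvd (not_dvd_torsionOrder_of_not_anom W p hp hgood hna)
  have htd : padicValNat p Wd.torsionOrder = 0 :=
    padicValNat.eq_zero_of_not_dvd (not_dvd_torsionOrder_of_not_anom Wd p hp hgood_d hna_d)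
  have h := h57 W p hp hgood hred hna hr K hK hodd hlt hHN hHp hLK Wd hWd q qd hq hqd
  rw [ht, htd]
  simp only [Nat.cast_zero, mul_zero, sub_zero]
  linarith

/-- **(5.7) + the rank-`0` print shape of the partner ⟹ `BSD(E,p)` at `ord_{s=1} L(E,s) = 1`.**
For `W/ℚ` globally minimal elliptic and `p > 2` good with `E[p]` reducible and `a_p ≢ 1 (mod p)`,
`ord_{s=1} L(E,s) = 1`: granted (5.7) (`h57`), modularity (`hmod`: entire continuation and
`w(E) = -1`), Hoffstein–Luo (`hHL`: an admissible `K` with (a)–(d),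
`exists_admissibleField_of_rootNumber_eq_neg_one`), Gross–Zagier 1986 Thm. I.7.3 (`hGZ`:
`L'(E,1)/(Ω·Reg) ∈ ℚ`), Gross–Zagier–Kolyvagin (`hGZK`), and the rank-`0` print shape
`PPartRankZero Wd p` of every globally minimal model `Wd` of an admissible twist with
`ord_{s=1} L(E^K,s) = 0` (`hpartner` — [CGLS22] Thm. 5.1.4 / [CGS25] Thm. D (`r = 0`) for `E^K`),
Miller's `BSD(E,p)` holds: the argument of the proof of Thm. 5.3.1 after (5.7), in the kernel via
`bsdp_of_display_at_of_pPartRankZero`. [cite: CastellaGrossiLeeSkinner2022, proof of Thm. 5.3.1 ((a)–(d), (5.7), last sentence)]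
[cite: HoffsteinLuo1997, Theorem (§1)] [cite: GrossZagier1986, Thm. I.7.3]
[cite: Miller2011LMS, Def. 1.1] -/
theorem bsdp_rankOne_of_display57_of_partner (h57 : display57_rankOne_twist)
    (hmod : exists_isNewformOf) (hHL : HoffsteinLuo1997_exists_twist_L_one_ne_zero)
    (hGZ : GrossZagier1986_thm_I_7_3) (hGZK : rank_eq_analyticRank_of_analyticRank_le_one)
    (W : WeierstrassCurve ℚ) [W.IsElliptic] [W.IsGloballyMinimal] (p : ℕ) [Fact p.Prime]
    (hp : 2 < p) (hgood : Good W p) (hred : Red W p) (hna : ¬ Anom W p) (hr : W.analyticRank = 1)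
    (hpartner : ∀ (K : Type) [Field K] [NumberField K], IsImaginaryQuadratic K →
        Odd (NumberField.discr K) → NumberField.discr K < -4 →
        SatisfiesHeegnerHypothesis (W.conductorNorm ℤ) K → SatisfiesHeegnerHypothesis p K →
        (W.quadraticTwist (NumberField.discr K : ℚ)).entireLFunction 1 ≠ 0 →
      ∀ (Wd : WeierstrassCurve ℚ) [Wd.IsElliptic] [Wd.IsGloballyMinimal],
        (∃ C : VariableChange ℚ, C • Wd = W.quadraticTwist (NumberField.discr K : ℚ)) →
        Wd.analyticRank = 0 → PPartRankZero Wd p) :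
    BSDp W p := by
  -- `w(E) = -1` from `ord_{s=1} L(E,s) = 1` (functional equation sign, from modularity)
  have hw : W.rootNumber = -1 := by
    have h := even_analyticRank_iff_rootNumber_eq_one.rootNumber_eq_neg_one_pow (W := W)
      (even_analyticRank_iff_rootNumber_eq_one_of_exists_isNewformOf W hmod)
    rw [hr, pow_one] at h
    exact h
  -- the admissible auxiliary field `K` ((a)–(d)) and a globally minimal model `Wd` of `E^{(D_K)}`
  obtain ⟨K, _, _, hK, hodd, hlt, hHN, hHp, hLK⟩ :=
    exists_admissibleField_of_rootNumber_eq_neg_one hmod hHL W hw p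
  have hd0 : (NumberField.discr K : ℚ) ≠ 0 := by
    exact_mod_cast (show NumberField.discr K ≠ 0 by omega)
  obtain ⟨Wd, _, _, C, hC⟩ := exists_isGloballyMinimal_smul_eq_quadraticTwist W hd0
  -- the twist has analytic rank `0`
  have hLd : Wd.entireLFunction 1 ≠ 0 := by
    rw [← Wd.entireLFunction_smul C, hC]
    exact hLK
  have hrd : Wd.analyticRank = 0 := analyticRank_eq_zero_of_entireLFunction_one_ne_zero Wd hLd
  -- the partner's rank-`0` print shape, then the display
  have hP : PPartRankZero Wd p := hpartner K hK hodd hlt hHN hHp hLK Wd ⟨C, hC⟩ hrd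
  exact bsdp_of_display_at_of_pPartRankZero hmod hGZ hGZK W p hr Wd hP
    (display_at_of_display57 h57 hp hgood hred hna hr K hK hodd hlt hHN hHp hLK Wd ⟨C, hC⟩)

/-- **Castella–Grossi–Skinner 2025 Thm. D, case `r = 1`, re-assembled in the kernel from its printed
pieces.** For `W/ℚ` globally minimal elliptic, `p > 2` good with `E[p]` reducible and
`a_p ≢ 1 (mod p)`, and `ord_{s=1} L(E,s) = 1`: Miller's `BSD(E,p)`. Printed proof: "In the case
`r = 1`, we argue as in [CGLS22] [= (5.7), `h57`], choosing a suitable `K` with `L(E^K,1) ≠ 0`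
[Hoffstein–Luo, `hHL`] and applying our result in the rank `0` case to `E^K`" — the partner is again
good, Eisenstein and non-anomalous at `p` (`partner_good_red_not_anom`), so Theorem A (`hA`, the
typed fact `CastellaGrossiSkinner2025.thmA_charIdeal_eq_padicLFunction`) with Greenberg's Thm. 4.1
(`hGr`), modularity (`hmodP`) and GZK gives its rank-`0` print shape
(`CastellaGrossiSkinner2025.pPartRankZero_of_thmA`). Compare `CastellaGrossiSkinner2025.bsdp_of_thmD`
(A47: Thm. D itself as the named fact) and, on the anomalous side, x1a's
`bsdp_of_classX1_of_analyticRank_eq_one_of_KY_OPEN` (same skeleton, OPEN display).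
[cite: CastellaGrossiSkinner2025, Thm. D (= "Thm. 4") and its proof (§0.3 p. 5), Theorem A]
[cite: CastellaGrossiLeeSkinner2022, proof of Thm. 5.3.1, display (5.7)]
[cite: GreenbergLNM1716, Thm. 4.1 (p. 102)] -/
theorem bsdp_rankOne_of_display57_of_thmA (h57 : display57_rankOne_twist)
    (hA : CastellaGrossiSkinner2025.thmA_charIdeal_eq_padicLFunction)
    (hGr : greenberg_charValue_rankZero) (hmodP : nonempty_modularParametrizationData)
    (hmod : exists_isNewformOf) (hHL : HoffsteinLuo1997_exists_twist_L_one_ne_zero)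
    (hGZ : GrossZagier1986_thm_I_7_3) (hGZK : rank_eq_analyticRank_of_analyticRank_le_one)
    (W : WeierstrassCurve ℚ) [W.IsElliptic] [W.IsGloballyMinimal] (p : ℕ) [Fact p.Prime]
    (hp : 2 < p) (hgood : Good W p) (hred : Red W p) (hna : ¬ Anom W p) (hr : W.analyticRank = 1) :
    BSDp W p := by
  refine bsdp_rankOne_of_display57_of_partner h57 hmod hHL hGZ hGZK W p hp hgood hred hna hr ?_
  intro K _ _ hK hodd _ _ hHp hLK Wd _ _ hWd hrd
  obtain ⟨hgood_d, hred_d, hna_d⟩ := partner_good_red_not_anom hp hgood hred hna K hK hodd hHp Wd hWd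
  have hord_d : GoodOrd Wd p := goodOrd_of_red_of_good Wd p hp hgood_d hred_d
  have hLd : Wd.entireLFunction 1 ≠ 0 := entireLFunction_one_ne_zero_of_analyticRank_eq_zero hmodP Wd hrd
  exact CastellaGrossiSkinner2025.pPartRankZero_of_thmA hA hmodP hGZK Wd p hp hgood_d hred_d hna_d hLd
    (fun κ γ hκ hγ hγ' D _ hX fE hfE hSel ↦
      hGr Wd p (by omega) hgood_d hord_d.2 κ γ hκ hγ hγ' D hX fE hfE hSel)

/-- **Castella–Grossi–Skinner 2025 Thm. D (`r ∈ {0,1}`) re-assembled: `BSD(E,p)` for every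
`E/ℚ` with `ord_{s=1} L(E,s) ≤ 1` at every good Eisenstein prime `p > 2` with `a_p ≢ 1 (mod p)`**,
from the typed Theorem A (`hA`; `r = 0` directly, session 1's `pPartRankZero_of_thmA`) and the typed
display (5.7) (`h57`; `r = 1`, `bsdp_rankOne_of_display57_of_thmA`), with Greenberg Thm. 4.1,
modularity, Hoffstein–Luo, Gross–Zagier, GZK — every input a named tree fact, no `_OPEN` one. The
row C6 of the cell's partition, one level deeper than A47.
[cite: CastellaGrossiSkinner2025, Thm. D (= "Thm. 4") and its proof (§0.3 p. 5)]
[cite: CastellaGrossiLeeSkinner2022, Thm. 5.1.4 and proof of Thm. 5.3.1] -/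
theorem bsdp_of_display57_of_thmA (h57 : display57_rankOne_twist)
    (hA : CastellaGrossiSkinner2025.thmA_charIdeal_eq_padicLFunction)
    (hGr : greenberg_charValue_rankZero) (hmodP : nonempty_modularParametrizationData)
    (hmod : exists_isNewformOf) (hHL : HoffsteinLuo1997_exists_twist_L_one_ne_zero)
    (hGZ : GrossZagier1986_thm_I_7_3) (hGZK : rank_eq_analyticRank_of_analyticRank_le_one)
    (W : WeierstrassCurve ℚ) [W.IsElliptic] [W.IsGloballyMinimal] (p : ℕ) [Fact p.Prime]
    (hp : 2 < p) (hgood : Good W p) (hred : Red W p) (hna : ¬ Anom W p) (hr : W.analyticRank ≤ 1) :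
    BSDp W p := by
  rcases Nat.le_one_iff_eq_zero_or_eq_one.mp hr with h0 | h1
  · have hL : W.entireLFunction 1 ≠ 0 := entireLFunction_one_ne_zero_of_analyticRank_eq_zero hmodP W h0
    have hord : GoodOrd W p := goodOrd_of_red_of_good W p hp hgood hred
    have hP : PPartRankZero W p :=
      CastellaGrossiSkinner2025.pPartRankZero_of_thmA hA hmodP hGZK W p hp hgood hred hna hL
        (fun κ γ hκ hγ hγ' D _ hX fE hfE hSel ↦
          hGr W p (by omega) hgood hord.2 κ γ hκ hγ hγ' D hX fE hfE hSel)
    exact bsdp_of_pPartRankZero W p (hasEntireLFunction_rat_of_exists_isNewformOf hmod) hGZK h0 hP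
  · exact bsdp_rankOne_of_display57_of_thmA h57 hA hGr hmodP hmod hHL hGZ hGZK W p hp hgood hred
      hna h1

/-! ### Per pair: the display instance carries exactly the content of `BSD(E,p)` -/

/-- **PER PAIR, at a non-anomalous rank-one Eisenstein pair: the (5.7)-instance ⟺ `BSD(E,p)`.**
Let `W/ℚ` be globally minimal elliptic, `p > 2` good with `E[p]` reducible and `a_p ≢ 1 (mod p)`,
`ord_{s=1} L(E,s) = 1`, `K` imaginary quadratic with `D_K` odd and `p` split and `L(E^{(D_K)},1) ≠ 0`,
`Wd` a globally minimal model of the twist. The partner's rank-`0` print shape is PUBLISHED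
(Theorem A route, as in `bsdp_rankOne_of_display57_of_thmA`), whence the Keller–Yin-shaped display
instance at `(W, p, Wd)` holds iff `BSDp W p` (`bsdp_of_display_at_of_pPartRankZero` /
`display_at_of_bsdp_of_pPartRankZero`): pair by pair the anticyclotomic package of CGLS22 and the
`p`-part of BSD have the same content on the published record — the non-anomalous twin of x1a's
`display_at_iff_bsdp_of_not_gvPar`. [cite: CastellaGrossiLeeSkinner2022, proof of Thm. 5.3.1, display (5.7)]
[cite: CastellaGrossiSkinner2025, Theorem A, Thm. D] [cite: Miller2011LMS, Def. 1.1] -/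
theorem display_at_iff_bsdp_of_not_anom
    (hA : CastellaGrossiSkinner2025.thmA_charIdeal_eq_padicLFunction)
    (hGr : greenberg_charValue_rankZero) (hmodP : nonempty_modularParametrizationData)
    (hmod : exists_isNewformOf) (hGZ : GrossZagier1986_thm_I_7_3)
    (hGZK : rank_eq_analyticRank_of_analyticRank_le_one)
    (W : WeierstrassCurve ℚ) [W.IsElliptic] [W.IsGloballyMinimal] (p : ℕ) [Fact p.Prime]
    (hp : 2 < p) (hgood : Good W p) (hred : Red W p) (hna : ¬ Anom W p) (hr : W.analyticRank = 1)
    (K : Type) [Field K] [NumberField K] (hK : IsImaginaryQuadratic K)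
    (hodd : Odd (NumberField.discr K)) (hHp : SatisfiesHeegnerHypothesis p K)
    (hLK : (W.quadraticTwist (NumberField.discr K : ℚ)).entireLFunction 1 ≠ 0)
    (Wd : WeierstrassCurve ℚ) [Wd.IsElliptic] [Wd.IsGloballyMinimal]
    (hWd : ∃ C : VariableChange ℚ, C • Wd = W.quadraticTwist (NumberField.discr K : ℚ)) :
    (∀ (q qd : ℚ), W.leadingLCoeff / ((W.realPeriodRat * W.regulator : ℝ) : ℂ) = (q : ℂ) →
        Wd.entireLFunction 1 / (Wd.realPeriodRat : ℂ) = (qd : ℂ) →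
        padicValRat p q - ((padicValNat p W.shaOrder : ℤ) + padicValNat p W.tamagawaProduct -
            2 * padicValNat p W.torsionOrder) =
          -(padicValRat p qd - ((padicValNat p Wd.shaOrder : ℤ) + padicValNat p Wd.tamagawaProduct -
            2 * padicValNat p Wd.torsionOrder))) ↔
    BSDp W p := by
  obtain ⟨hgood_d, hred_d, hna_d⟩ := partner_good_red_not_anom hp hgood hred hna K hK hodd hHp Wd hWd
  have hord_d : GoodOrd Wd p := goodOrd_of_red_of_good Wd p hp hgood_d hred_d
  obtain ⟨C, hC⟩ := hWd
  have hLd : Wd.entireLFunction 1 ≠ 0 := by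
    rw [← Wd.entireLFunction_smul C, hC]
    exact hLK
  have hpartner : PPartRankZero Wd p :=
    CastellaGrossiSkinner2025.pPartRankZero_of_thmA hA hmodP hGZK Wd p hp hgood_d hred_d hna_d hLd
      (fun κ γ hκ hγ hγ' D _ hX fE hfE hSel ↦
        hGr Wd p (by omega) hgood_d hord_d.2 κ γ hκ hγ hγ' D hX fE hfE hSel)
  exact ⟨fun hdisp ↦ bsdp_of_display_at_of_pPartRankZero hmod hGZ hGZK W p hr Wd hpartner hdisp,
    fun hB ↦ display_at_of_bsdp_of_pPartRankZero hmod hGZK W p (by omega) hB Wd hpartner⟩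

/-! ### Appended: Theorem F itself = (5.7) + Greenberg–Vatsal on the partner (the printed proof
of Thm. 5.3.1 end to end; no CGS 2025 input) -/

/-- **The partner's rank-`0` print shape from Greenberg–Vatsal, when `E` has a rational line of
co-type** ("Finally, by our hypotheses on `φ` the curve `E^K` satisfies the hypotheses of Theorem
5.1.4 [GV00]"): for `W/ℚ` globally minimal elliptic, `p > 2` good with `E[p]` reducible and
`a_p ≢ 1 (mod p)`, a rational line `Φ ⊂ E[p]` whose character is (ramified at `p` ∧ odd) ∨
(unramified at `p` ∧ even) — the second bullet of Thm. 5.3.1 —, `K` imaginary quadratic with `D_K`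
odd and `p` split, and a globally minimal model `Wd` of `E^{(D_K)}` with `ord_{s=1} L(E^K,s) = 0`:
`PPartRankZero Wd p`. Steps: the odd twist unramified at `p` turns the co-type line into a GV-type
line (`gvPar_twist_iff_exists_coType_of_neg`, the last paragraph of the printed proof), `Wd` is good
ordinary Eisenstein (`partner_good_red_not_anom`, `goodOrd_of_red_of_good`), so Greenberg–Vatsal 2000
Thm. 1.3 (`hGV`) gives Mazur's (MC) for `(Wd, p)` and Thm. 5.1.4's proof
(`padicValRat_bsd_rank_zero_of_mazurMainConjecture` with Greenberg Thm. 4.1 `hGr`, modularity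
`hmodP`, GZK) gives the print shape. [cite: CastellaGrossiLeeSkinner2022, proof of Thm. 5.3.1 (last paragraph) and Thm. 5.1.4]
[cite: GreenbergVatsal2000, Thm. (1.3)] [cite: GreenbergLNM1716, Thm. 4.1 (p. 102)] -/
theorem pPartRankZero_partner_of_gvThm13_of_coType
    (hGV : GreenbergVatsal2000.thm13_charIdeal_eq_of_gvPar) (hGr : greenberg_charValue_rankZero)
    (hmodP : nonempty_modularParametrizationData)
    (hGZK : rank_eq_analyticRank_of_analyticRank_le_one)
    (hp : 2 < p) (hgood : Good W p) (hred : Red W p) (hna : ¬ Anom W p)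
    (hco : ∃ Φ : AddSubgroup (geomTorsion W (p : ℤ)), IsRationalLine W p Φ ∧
      ((¬ LineUnramifiedAt W p Φ ∧ LineOdd W p Φ) ∨ (LineUnramifiedAt W p Φ ∧ LineEven W p Φ)))
    (K : Type) [Field K] [NumberField K] (hK : IsImaginaryQuadratic K)
    (hodd : Odd (NumberField.discr K)) (hHp : SatisfiesHeegnerHypothesis p K)
    (Wd : WeierstrassCurve ℚ) [Wd.IsElliptic] [Wd.IsGloballyMinimal]
    (hWd : ∃ C : VariableChange ℚ, C • Wd = W.quadraticTwist (NumberField.discr K : ℚ))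
    (hrd : Wd.analyticRank = 0) : PPartRankZero Wd p := by
  have hpP : p.Prime := Fact.out
  have hp2 : p ≠ 2 := by omega
  obtain ⟨hgood_d, hred_d, -⟩ := partner_good_red_not_anom hp hgood hred hna K hK hodd hHp Wd hWd
  have hord_d : GoodOrd Wd p := goodOrd_of_red_of_good Wd p hp hgood_d hred_d
  obtain ⟨C, hC⟩ := hWd
  have hdneg : NumberField.discr K < 0 := IsImaginaryQuadratic.discr_neg hK
  have hpd : ¬ (p : ℤ) ∣ NumberField.discr K := not_dvd_discr_of_split hK hpP hp2 hHp
  have hpar_d : GVPar Wd p := by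
    obtain ⟨Φ, hΦ, h⟩ := hco
    exact (gvPar_twist_iff_exists_coType_of_neg hp2 hdneg hpd C hC).mpr ⟨Φ, hΦ, h.symm⟩
  have hLd : Wd.entireLFunction 1 ≠ 0 :=
    entireLFunction_one_ne_zero_of_analyticRank_eq_zero hmodP Wd hrd
  obtain ⟨-, hfin_d⟩ := hGZK Wd (by omega)
  exact padicValRat_bsd_rank_zero_of_mazurMainConjecture Wd p hgood_d hord_d.2 hLd hfin_d hmodP
    (fun κ γ hκ hγ hγ' D _ hX fE hfE hSel ↦
      hGr Wd p hp2 hgood_d hord_d.2 κ γ hκ hγ hγ' D hX fE hfE hSel)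
    (hGV Wd p hp2 hgood_d hord_d.2 hpar_d)

/-- **Castella–Grossi–Lee–Skinner 2022 Theorem F (= Thm. 5.3.1) re-assembled in the kernel from its
printed proof, end to end**: for `W/ℚ` globally minimal elliptic, `p > 2` good with `E[p]` reducible,
`a_p ≢ 1 (mod p)` (first bullet), a rational line of character (ramified ∧ odd) ∨ (unramified ∧
even) (second bullet) and `ord_{s=1} L(E,s) = 1`: Miller's `BSD(E,p)` — from display (5.7) (`h57`),
Greenberg–Vatsal 2000 Thm. 1.3 on the partner (`hGV`, through
`pPartRankZero_partner_of_gvThm13_of_coType`), Greenberg Thm. 4.1 (`hGr`), modularity (`hmodP`,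
`hmod`), Hoffstein–Luo (`hHL`), Gross–Zagier I.7.3 (`hGZ`) and GZK. NO Castella–Grossi–Skinner 2025
input: every named fact used is published and outside the cell's `CGS25-BST-Thm311` documentation
flag. Compare A52 (`thmF_padicValRat_bsd_rank_one`, Thm. F itself as the named fact) and its
consumers `bsdp_of_thmF`, `Rank1Residual.bsdp_of_thmF_of_not_gvPar`.
[cite: CastellaGrossiLeeSkinner2022, Theorem F = Thm. 5.3.1 and its proof ((a)–(d), (5.5)–(5.7), last paragraph)]
[cite: GreenbergVatsal2000, Thm. (1.3)] [cite: GreenbergLNM1716, Thm. 4.1 (p. 102)]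
[cite: HoffsteinLuo1997, Theorem (§1)] [cite: GrossZagier1986, Thm. I.7.3] -/
theorem bsdp_rankOne_of_display57_of_gvThm13 (h57 : display57_rankOne_twist)
    (hGV : GreenbergVatsal2000.thm13_charIdeal_eq_of_gvPar) (hGr : greenberg_charValue_rankZero)
    (hmodP : nonempty_modularParametrizationData) (hmod : exists_isNewformOf)
    (hHL : HoffsteinLuo1997_exists_twist_L_one_ne_zero) (hGZ : GrossZagier1986_thm_I_7_3)
    (hGZK : rank_eq_analyticRank_of_analyticRank_le_one)
    (W : WeierstrassCurve ℚ) [W.IsElliptic] [W.IsGloballyMinimal] (p : ℕ) [Fact p.Prime]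
    (hp : 2 < p) (hgood : Good W p) (hred : Red W p) (hna : ¬ Anom W p)
    (hco : ∃ Φ : AddSubgroup (geomTorsion W (p : ℤ)), IsRationalLine W p Φ ∧
      ((¬ LineUnramifiedAt W p Φ ∧ LineOdd W p Φ) ∨ (LineUnramifiedAt W p Φ ∧ LineEven W p Φ)))
    (hr : W.analyticRank = 1) : BSDp W p :=
  bsdp_rankOne_of_display57_of_partner h57 hmod hHL hGZ hGZK W p hp hgood hred hna hr
    (fun K _ _ hK hodd _ _ hHp _ Wd _ _ hWd hrd ↦
      pPartRankZero_partner_of_gvThm13_of_coType hGV hGr hmodP hGZK hp hgood hred hna hco K hK hodd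
        hHp Wd hWd hrd)

/-- **Theorem F on the cell's type-A sub-locus** (`¬ GVPar W p`: no rational line of GV type, so —
`E[p]` being reducible — some rational line is of co-type, `exists_coTypeLine_of_red_of_not_gvPar`):
the (5.7) + Greenberg–Vatsal assembly in the spelling of `Rank1Residual.bsdp_of_thmF_of_not_gvPar`.
[cite: CastellaGrossiLeeSkinner2022, Theorem F = Thm. 5.3.1 and its proof]
[cite: GreenbergVatsal2000, Thm. (1.3)] -/
theorem bsdp_rankOne_of_display57_of_gvThm13_of_not_gvPar (h57 : display57_rankOne_twist)
    (hGV : GreenbergVatsal2000.thm13_charIdeal_eq_of_gvPar) (hGr : greenberg_charValue_rankZero)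
    (hmodP : nonempty_modularParametrizationData) (hmod : exists_isNewformOf)
    (hHL : HoffsteinLuo1997_exists_twist_L_one_ne_zero) (hGZ : GrossZagier1986_thm_I_7_3)
    (hGZK : rank_eq_analyticRank_of_analyticRank_le_one)
    (W : WeierstrassCurve ℚ) [W.IsElliptic] [W.IsGloballyMinimal] (p : ℕ) [Fact p.Prime]
    (hp : 2 < p) (hgood : Good W p) (hred : Red W p) (hna : ¬ Anom W p) (hnpar : ¬ GVPar W p)
    (hr : W.analyticRank = 1) : BSDp W p :=
  bsdp_rankOne_of_display57_of_gvThm13 h57 hGV hGr hmodP hmod hHL hGZ hGZK W p hp hgood hred hna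
    (exists_coTypeLine_of_red_of_not_gvPar W p hred hnpar) hr

end Literature.NumberTheory.EllipticCurves.CastellaGrossiLeeSkinner2022

end
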